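import Summits.Langlands.Langlands.Theses.ExteriorSquareAscent
import Literature.NumberTheory.Automorphic.ExteriorSquareNoHeckeEigenvalueGL4
import Literature.NumberTheory.Automorphic.CuspidalContragredientProofs
import Literature.NumberTheory.Automorphic.PairLFunctionPolesRepDataRankTwo
import Literature.NumberTheory.Automorphic.RamakrishnanBoxTimesProofs
import Literature.NumberTheory.Automorphic.PairLFunctionPolesRankNeLandau
import Literature.NumberTheory.Automorphic.ArthurClozelGalOrbitLift

/-!
# Stub `stub_noPlanesAnalytic` of line `Sketch` for crux stmt-Langlands-18054 — I: the 46-term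
Euler-factor identity of the `(2,2)` case, six-by-six bookkeeping, and analytic packages

(`Summit.Langlands.Langlands.Theses.ExteriorSquareAscent.ReducibleInducesSquare`; serving the glue item
stmt-Langlands-18147 `ReducibleInducesSquareGivenJSAR`.)

Let `t = β ⊔ γ` be a Satake parameter of `GL(4)` split into two pairs, `x = ∏ β`, `y = ∏ γ`, `l = y/x`,
`Λ = ∧² t = {x} ⊔ {y} ⊔ β ⊗ γ`, `t⁻¹ = x⁻¹ β ⊔ y⁻¹ γ` (a pair is self-dual up to its determinant).  Then,
as 46-element multisets (card `dual-pair-rankin-selberg-syzygy` of crux stmt-Langlands-18054),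

  `l·(t ⊗ t⁻¹) ⊔ l²·(t ⊗ t⁻¹) ⊔ {1} ⊔ {l³} ⊔ 2·(l x⁻¹)·Λ
    = (l x⁻¹)·(t ⊗ t) ⊔ (x l²)·(t⁻¹ ⊗ t⁻¹) ⊔ {l} ⊔ {l²} ⊔ x⁻¹·Λ ⊔ (l² x⁻¹)·Λ`,

both sides being `(l x⁻¹ ⊔ l² x⁻¹)·β⊗β ⊔ (x⁻¹ ⊔ l x⁻¹)·γ⊗γ ⊔ (x⁻¹ ⊔ 4·l x⁻¹ ⊔ l² x⁻¹)·β⊗γ ⊔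
{1, l, l, l², l², l³}`.  Factor by factor this is the identity of partial Euler products

  `L(π × π^∨ ⊗ λ) L(π × π^∨ ⊗ λ²) ζ_K L(λ³) L(Π ⊗ λχ⁻¹)²
    = L(π × (π ⊗ λχ⁻¹)) L(π^∨ × (π^∨ ⊗ χλ²)) L(λ) L(λ²) L(Π ⊗ χ⁻¹) L(Π ⊗ λ²χ⁻¹)`

(`χ(ϖ) = x`, `λ = ω_π χ⁻²`, `λ(ϖ) = l`, `Π` the exterior square) used by `stub_noPlanesAnalytic`.  The
proof expands both sides into Euler polynomials of the blocks `β⊗β`, `β⊗γ`, `γ⊗γ` and singletons and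
matches them block by block (no expansion of the degree-46 polynomials).

## Also in this file
* `partialPairL_prod_six_eq_of_satakePairPolynomial`, `false_of_weighted_identity` — six Euler products against six;
* `analyticPackage_fourFour`, `analyticPackage_oneOne`, `exists_pow_mul_tendsto_of_package` — the analytic packages of
  `GL₄ × GL₄` pairs ((2.2)/(2.3) granted) and `GL₁ × GL₁` pairs (theorems of the tree) of Borel–Jacquet data.
-/

set_option linter.dupNamespace false -- `Summit.Langlands.Langlands` is the mandated namespace

noncomputable section

namespace Summit.Langlands.Langlands.Cruxes.ReducibleInducesSquare.Sketch

open Literature.NumberTheory.GaloisRepresentations Literature.NumberTheory.Automorphic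
open NumberField IsDedekindDomain Filter Polynomial
open scoped Classical MatrixGroups NumberField Topology

/-! ### Multiset bookkeeping -/

/-- `P(A, c·B) = ∏_{a ∈ A, b ∈ B} (1 - c a b T)`: the Rankin–Selberg polynomial of a twisted pair is
the Euler polynomial of the twisted pair parameters. [folklore] -/
theorem np_satakePairPolynomial_map_mul_right (α β : Multiset ℂ) (c : ℂ) :
    satakePairPolynomial α (β.map (c * ·)) = eulerPolynomial ((satakeTensor α β).map (c * ·)) := by
  rw [satakePairPolynomial_eq_eulerPolynomial, satakeTensor_map_mul_right]

/-- `P(A, {c}) = ∏_{a ∈ A} (1 - c a T)`. [folklore] -/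
theorem np_satakePairPolynomial_singleton_right (α : Multiset ℂ) (c : ℂ) :
    satakePairPolynomial α {c} = eulerPolynomial (α.map (c * ·)) := by
  rw [satakePairPolynomial_eq_eulerPolynomial, satakeTensor_comm, satakeTensor_singleton_left]

/-- Nested twists compose: `c·(d·A) = (c d)·A`. [folklore] -/
theorem np_map_const_mul_map_const_mul (α : Multiset ℂ) (c d : ℂ) :
    (α.map (d * ·)).map (c * ·) = α.map ((c * d) * ·) := by
  rw [Multiset.map_map]
  exact Multiset.map_congr rfl fun a _ => by simp only [Function.comp_apply, mul_assoc]

/-- **A pair is self-dual up to its determinant**: for a two-element multiset `β` of non-zero numbers,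
`β⁻¹ = (∏ β)⁻¹ · β` (`{1/b₁, 1/b₂} = {b₂/(b₁b₂), b₁/(b₁b₂)}`). [folklore] -/
theorem np_map_inv_of_card_eq_two {β : Multiset ℂ} (h2 : Multiset.card β = 2) (h0 : (0 : ℂ) ∉ β) :
    β.map (·⁻¹) = β.map ((β.prod)⁻¹ * ·) := by
  obtain ⟨a, b, rfl⟩ := Multiset.card_eq_two.1 h2
  have ha : a ≠ 0 := fun h => h0 (by simp [h])
  have hb : b ≠ 0 := fun h => h0 (by simp [h])
  have e1 : (a * b)⁻¹ * a = b⁻¹ := by field_simp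
  have e2 : (a * b)⁻¹ * b = a⁻¹ := by field_simp
  simp only [Multiset.insert_eq_cons, Multiset.map_cons, Multiset.map_singleton, Multiset.prod_cons,
    Multiset.prod_singleton, e1, e2]
  exact Multiset.cons_swap _ _ _

/-- `∧²` of a two-element parameter is its determinant. [folklore] -/
theorem np_wedgeTwoParams_of_card_eq_two {β : Multiset ℂ} (h2 : Multiset.card β = 2) :
    wedgeTwoParams β = {β.prod} := by
  obtain ⟨a, b, rfl⟩ := Multiset.card_eq_two.1 h2
  rw [wedgeTwoParams_pair, Multiset.insert_eq_cons, Multiset.prod_cons, Multiset.prod_singleton]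

/-! ### The 46-term identity -/

/-- **The 46-term Euler-factor identity of the `(2,2)` case** (module docstring): for two-element
multisets `β`, `γ` of non-zero numbers with `∏ β = x`, `∏ γ = l x` (`l = λ(ϖ)`), `t = β ⊔ γ`,
`t⁻¹ = t.map (·⁻¹)`, `Λ = ∧² t`:
`P(t, l·t⁻¹) P(t, l²·t⁻¹) P(1, 1) P(l³, 1) P(Λ, l x⁻¹)² =
 P(t, (l x⁻¹)·t) P(t⁻¹, (x l²)·t⁻¹) P(l, 1) P(l², 1) P(Λ, x⁻¹) P(Λ, l² x⁻¹)`.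
[cite: Shavali2026, Prop. 4.2] [cite: JacquetShalikaAJM1981II, Prop. 3.6] -/
theorem satakePairPolynomial_twoTwo_identity {β γ : Multiset ℂ} {x l : ℂ}
    (hβ2 : Multiset.card β = 2) (hγ2 : Multiset.card γ = 2) (hβ0 : (0 : ℂ) ∉ β) (hγ0 : (0 : ℂ) ∉ γ)
    (hx : β.prod = x) (hy : γ.prod = l * x) (hx0 : x ≠ 0) (hl0 : l ≠ 0) :
    satakePairPolynomial (β + γ) (((β + γ).map (·⁻¹)).map (l * ·)) *
        satakePairPolynomial (β + γ) (((β + γ).map (·⁻¹)).map (l ^ 2 * ·)) *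
        satakePairPolynomial {1} {1} * satakePairPolynomial {l ^ 3} {1} *
        satakePairPolynomial (wedgeTwoParams (β + γ)) {l * x⁻¹} *
        satakePairPolynomial (wedgeTwoParams (β + γ)) {l * x⁻¹} =
      satakePairPolynomial (β + γ) ((β + γ).map (l * x⁻¹ * ·)) *
        satakePairPolynomial ((β + γ).map (·⁻¹)) (((β + γ).map (·⁻¹)).map (x * l ^ 2 * ·)) *
        satakePairPolynomial {l} {1} * satakePairPolynomial {l ^ 2} {1} *
        satakePairPolynomial (wedgeTwoParams (β + γ)) {x⁻¹} *
        satakePairPolynomial (wedgeTwoParams (β + γ)) {l ^ 2 * x⁻¹} := by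
  have hβi : β.map (·⁻¹) = β.map (x⁻¹ * ·) := by rw [np_map_inv_of_card_eq_two hβ2 hβ0, hx]
  have hγi : γ.map (·⁻¹) = γ.map ((l * x)⁻¹ * ·) := by rw [np_map_inv_of_card_eq_two hγ2 hγ0, hy]
  have hW : wedgeTwoParams (β + γ) = {x} + satakeTensor β γ + {l * x} := by
    rw [wedgeTwoParams_add, np_wedgeTwoParams_of_card_eq_two hβ2, np_wedgeTwoParams_of_card_eq_two hγ2,
      hx, hy]
  have hlx : l * x ≠ 0 := mul_ne_zero hl0 hx0
  -- the coefficient bookkeeping (`x = χ(ϖ)`, `l = λ(ϖ)`, `l x = η(ϖ)`)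
  have e1 : l * x⁻¹ * x = l := by field_simp
  have e2 : l * x⁻¹ * (l * x) = l ^ 2 := by field_simp
  have e3 : x⁻¹ * x = 1 := inv_mul_cancel₀ hx0
  have e4 : x⁻¹ * (l * x) = l := by field_simp
  have e5 : l ^ 2 * x⁻¹ * x = l ^ 2 := by field_simp
  have e6 : l ^ 2 * x⁻¹ * (l * x) = l ^ 3 := by field_simp
  have e7 : l * (l * x)⁻¹ = x⁻¹ := by field_simp
  have e8 : l ^ 2 * (l * x)⁻¹ = l * x⁻¹ := by field_simp
  have e9 : x * l ^ 2 * x⁻¹ * x⁻¹ = l ^ 2 * x⁻¹ := by field_simp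
  have e10 : x * l ^ 2 * x⁻¹ * (l * x)⁻¹ = l * x⁻¹ := by field_simp
  have e11 : x * l ^ 2 * (l * x)⁻¹ * x⁻¹ = l * x⁻¹ := by field_simp
  have e12 : x * l ^ 2 * (l * x)⁻¹ * (l * x)⁻¹ = x⁻¹ := by field_simp
  rw [hW]
  simp only [Multiset.map_add, hβi, hγi, np_map_const_mul_map_const_mul, satakePairPolynomial_add_right,
    np_satakePairPolynomial_map_mul_right, np_satakePairPolynomial_singleton_right,
    satakeTensor_add_left, satakeTensor_map_mul_left, satakeTensor_comm γ β, Multiset.map_singleton,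
    eulerPolynomial_add, one_mul]
  simp only [e1, e2, e3, e4, e5, e6, e7, e8, e9, e10, e11, e12]
  ring



section SixBySix

variable {K : Type} [Field K] [NumberField K]

/-- **An identity of partial `L`-functions, six factors against six, from an identity of Euler
factors.** [folklore] -/
theorem partialPairL_prod_six_eq_of_satakePairPolynomial {S : Set (HeightOneSpectrum (𝓞 K))}
    {a₁ b₁ a₂ b₂ a₃ b₃ a₄ b₄ a₅ b₅ a₆ b₆ c₁ d₁ c₂ d₂ c₃ d₃ c₄ d₄ c₅ d₅ c₆ d₆ : SatakeFamily K}
    (hId : ∀ v ∉ S,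
      satakePairPolynomial (a₁ v) (b₁ v) * satakePairPolynomial (a₂ v) (b₂ v) *
        satakePairPolynomial (a₃ v) (b₃ v) * satakePairPolynomial (a₄ v) (b₄ v) *
        satakePairPolynomial (a₅ v) (b₅ v) * satakePairPolynomial (a₆ v) (b₆ v) =
      satakePairPolynomial (c₁ v) (d₁ v) * satakePairPolynomial (c₂ v) (d₂ v) *
        satakePairPolynomial (c₃ v) (d₃ v) * satakePairPolynomial (c₄ v) (d₄ v) *
        satakePairPolynomial (c₅ v) (d₅ v) * satakePairPolynomial (c₆ v) (d₆ v))
    {s : ℂ}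
    (h₁ : Multipliable fun v : {v : HeightOneSpectrum (𝓞 K) // v ∉ S} =>
      ((satakePairPolynomial (a₁ v.1) (b₁ v.1)).eval ((v.1.residueCard : ℂ) ^ (-s)))⁻¹)
    (h₂ : Multipliable fun v : {v : HeightOneSpectrum (𝓞 K) // v ∉ S} =>
      ((satakePairPolynomial (a₂ v.1) (b₂ v.1)).eval ((v.1.residueCard : ℂ) ^ (-s)))⁻¹)
    (h₃ : Multipliable fun v : {v : HeightOneSpectrum (𝓞 K) // v ∉ S} =>
      ((satakePairPolynomial (a₃ v.1) (b₃ v.1)).eval ((v.1.residueCard : ℂ) ^ (-s)))⁻¹)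
    (h₄ : Multipliable fun v : {v : HeightOneSpectrum (𝓞 K) // v ∉ S} =>
      ((satakePairPolynomial (a₄ v.1) (b₄ v.1)).eval ((v.1.residueCard : ℂ) ^ (-s)))⁻¹)
    (h₅ : Multipliable fun v : {v : HeightOneSpectrum (𝓞 K) // v ∉ S} =>
      ((satakePairPolynomial (a₅ v.1) (b₅ v.1)).eval ((v.1.residueCard : ℂ) ^ (-s)))⁻¹)
    (h₆ : Multipliable fun v : {v : HeightOneSpectrum (𝓞 K) // v ∉ S} =>
      ((satakePairPolynomial (a₆ v.1) (b₆ v.1)).eval ((v.1.residueCard : ℂ) ^ (-s)))⁻¹)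
    (g₁ : Multipliable fun v : {v : HeightOneSpectrum (𝓞 K) // v ∉ S} =>
      ((satakePairPolynomial (c₁ v.1) (d₁ v.1)).eval ((v.1.residueCard : ℂ) ^ (-s)))⁻¹)
    (g₂ : Multipliable fun v : {v : HeightOneSpectrum (𝓞 K) // v ∉ S} =>
      ((satakePairPolynomial (c₂ v.1) (d₂ v.1)).eval ((v.1.residueCard : ℂ) ^ (-s)))⁻¹)
    (g₃ : Multipliable fun v : {v : HeightOneSpectrum (𝓞 K) // v ∉ S} =>
      ((satakePairPolynomial (c₃ v.1) (d₃ v.1)).eval ((v.1.residueCard : ℂ) ^ (-s)))⁻¹)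
    (g₄ : Multipliable fun v : {v : HeightOneSpectrum (𝓞 K) // v ∉ S} =>
      ((satakePairPolynomial (c₄ v.1) (d₄ v.1)).eval ((v.1.residueCard : ℂ) ^ (-s)))⁻¹)
    (g₅ : Multipliable fun v : {v : HeightOneSpectrum (𝓞 K) // v ∉ S} =>
      ((satakePairPolynomial (c₅ v.1) (d₅ v.1)).eval ((v.1.residueCard : ℂ) ^ (-s)))⁻¹)
    (g₆ : Multipliable fun v : {v : HeightOneSpectrum (𝓞 K) // v ∉ S} =>
      ((satakePairPolynomial (c₆ v.1) (d₆ v.1)).eval ((v.1.residueCard : ℂ) ^ (-s)))⁻¹) :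
    partialPairL S a₁ b₁ s * partialPairL S a₂ b₂ s * partialPairL S a₃ b₃ s *
        partialPairL S a₄ b₄ s * partialPairL S a₅ b₅ s * partialPairL S a₆ b₆ s =
      partialPairL S c₁ d₁ s * partialPairL S c₂ d₂ s * partialPairL S c₃ d₃ s *
        partialPairL S c₄ d₄ s * partialPairL S c₅ d₅ s * partialPairL S c₆ d₆ s := by
  unfold partialPairL
  rw [← h₁.tprod_mul h₂, ← (h₁.mul h₂).tprod_mul h₃, ← ((h₁.mul h₂).mul h₃).tprod_mul h₄,
    ← (((h₁.mul h₂).mul h₃).mul h₄).tprod_mul h₅, ← ((((h₁.mul h₂).mul h₃).mul h₄).mul h₅).tprod_mul h₆,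
    ← g₁.tprod_mul g₂, ← (g₁.mul g₂).tprod_mul g₃, ← ((g₁.mul g₂).mul g₃).tprod_mul g₄,
    ← (((g₁.mul g₂).mul g₃).mul g₄).tprod_mul g₅, ← ((((g₁.mul g₂).mul g₃).mul g₄).mul g₅).tprod_mul g₆]
  congr 1
  funext v
  simp only [← mul_inv, ← eval_mul]
  rw [hId v.1 v.2]

/-- **Pole bookkeeping for a weighted identity**: if `L = R` eventually along `l`, `W · L → c ≠ 0` and
`W · R → 0` for one and the same weight `W`, contradiction. [folklore] -/
theorem false_of_weighted_identity {l : Filter ℂ} [l.NeBot] {L R W : ℂ → ℂ} {c : ℂ}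
    (hEq : ∀ᶠ s in l, L s = R s) (hL : Tendsto (fun s => W s * L s) l (𝓝 c)) (hc : c ≠ 0)
    (hR : Tendsto (fun s => W s * R s) l (𝓝 0)) : False :=
  hc (tendsto_nhds_unique (hL.congr' (hEq.mono fun s hs => by rw [hs])) hR)

end SixBySix


section Packages

variable {F : Type} [Field F] [NumberField F]

/-- **The analytic package of `L^S(s, π × π')` for two cuspidal Borel–Jacquet data on `GL₄(𝔸_F)`**
with unitary a.e. Satake families `α`, `β`: off a finite `S₀`, for every finite `S ⊇ S₀`, multipliability
on `Re s > 1` ((2.1)), continuity and non-vanishing on `Re s > 1` (Jacquet–Shalika I, Thm. 5.3), a finite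
non-zero limit at `s = 1` off `X` ((2.2), granted) and a simple pole with non-zero residue in `X`
((2.3), granted). [cite: ArthurClozelAMS120, Ch. 3 §2 (2.1)–(2.3)] [cite: JacquetShalikaAJM1981, Thm. (5.3)] -/
theorem analyticPackage_fourFour (hJ2 : JacquetShalika1981_partialPairL_boundary_repData)
    (hJ3 : JacquetShalika1981_partialPairL_pole_repData)
    {h4 : isCompact_glFiniteIntegralLevel 4 F} (P Q : CuspidalAutomorphicRepData 4 F h4)
    (α β : SatakeFamily F)
    (hP : ∀ᶠ w : HeightOneSpectrum (𝓞 F) in cofinite, P.1.HasSatakeParamAt w (α w))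
    (hQ : ∀ᶠ w : HeightOneSpectrum (𝓞 F) in cofinite, Q.1.HasSatakeParamAt w (β w))
    (huα : ∀ᶠ w : HeightOneSpectrum (𝓞 F) in cofinite, ‖(α w).prod‖ = 1)
    (huβ : ∀ᶠ w : HeightOneSpectrum (𝓞 F) in cofinite, ‖(β w).prod‖ = 1) :
    ∃ S₀ : Set (HeightOneSpectrum (𝓞 F)), S₀.Finite ∧
      ∀ {S : Set (HeightOneSpectrum (𝓞 F))} (_hS : S.Finite) (_hS₀ : S₀ ⊆ S),
        (∀ s : ℂ, 1 < s.re → Multipliable fun v : {v : HeightOneSpectrum (𝓞 F) // v ∉ S} =>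
          ((satakePairPolynomial (α v.1) (β v.1)).eval ((v.1.residueCard : ℂ) ^ (-s)))⁻¹) ∧
        (∀ s : ℂ, 1 < s.re → ContinuousAt (partialPairL S α β) s ∧ partialPairL S α β s ≠ 0) ∧
        ((¬ ∀ᶠ w : HeightOneSpectrum (𝓞 F) in cofinite,
            (α w).map ((((w.residueCard : ℂ) ^ (1 - (1 : ℂ)))) * ·) = (β w).map (·⁻¹)) →
          ∃ c : ℂ, c ≠ 0 ∧ Tendsto (partialPairL S α β) (𝓝[{s : ℂ | 1 < s.re}] 1) (𝓝 c)) ∧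
        ((∀ᶠ w : HeightOneSpectrum (𝓞 F) in cofinite,
            (α w).map ((((w.residueCard : ℂ) ^ (1 - (1 : ℂ)))) * ·) = (β w).map (·⁻¹)) →
          ∃ c : ℂ, c ≠ 0 ∧
            Tendsto (fun s => (s - 1) * partialPairL S α β s) (𝓝[{s : ℂ | 1 < s.re}] 1) (𝓝 c)) := by
  haveI : NeZero (4 : ℕ) := ⟨by norm_num⟩
  obtain ⟨S₁, hS₁, hJ1a⟩ :=
    JacquetShalika1981_multipliable_partialPairL_repData_holds 4 4 F h4 h4 (by norm_num) (by norm_num) P Q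
  obtain ⟨S₂, hS₂, hIa⟩ := continuousAt_and_ne_zero_partialPairL_repData P Q
  obtain ⟨S₃, hS₃, hJ2a⟩ := hJ2 4 4 F h4 h4 (by norm_num) (by norm_num) P Q
  obtain ⟨S₄, hS₄, hJ3a⟩ := hJ3 4 F h4 (by norm_num) P Q
  have hgood : ∀ᶠ w : HeightOneSpectrum (𝓞 F) in cofinite, P.1.HasSatakeParamAt w (α w) ∧
      Q.1.HasSatakeParamAt w (β w) ∧ ‖(α w).prod‖ = 1 ∧ ‖(β w).prod‖ = 1 := by
    filter_upwards [hP, hQ, huα, huβ] with w h₁ h₂ h₃ h₄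
    exact ⟨h₁, h₂, h₃, h₄⟩
  obtain ⟨E, hE, hgoodE⟩ : ∃ E : Set (HeightOneSpectrum (𝓞 F)), E.Finite ∧ ∀ w ∉ E,
      P.1.HasSatakeParamAt w (α w) ∧ Q.1.HasSatakeParamAt w (β w) ∧ ‖(α w).prod‖ = 1 ∧
      ‖(β w).prod‖ = 1 :=
    ⟨_, Filter.eventually_cofinite.1 hgood, fun w hw => not_not.1 hw⟩
  refine ⟨S₁ ∪ S₂ ∪ S₃ ∪ S₄ ∪ E, (((hS₁.union hS₂).union hS₃).union hS₄).union hE, ?_⟩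
  intro S hS hS₀
  have sub₁ : S₁ ⊆ S := fun x hx => hS₀ (by simp [hx])
  have sub₂ : S₂ ⊆ S := fun x hx => hS₀ (by simp [hx])
  have sub₃ : S₃ ⊆ S := fun x hx => hS₀ (by simp [hx])
  have sub₄ : S₄ ⊆ S := fun x hx => hS₀ (by simp [hx])
  have subE : E ⊆ S := fun x hx => hS₀ (by simp [hx])
  have hES : ∀ w ∉ S, w ∉ E := fun w hw h => hw (subE h)
  have hPS : ∀ w ∉ S, P.1.HasSatakeParamAt w (α w) := fun w hw => (hgoodE w (hES w hw)).1
  have hQS : ∀ w ∉ S, Q.1.HasSatakeParamAt w (β w) := fun w hw => (hgoodE w (hES w hw)).2.1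
  have huαS : ∀ w ∉ S, ‖(α w).prod‖ = 1 := fun w hw => (hgoodE w (hES w hw)).2.2.1
  have huβS : ∀ w ∉ S, ‖(β w).prod‖ = 1 := fun w hw => (hgoodE w (hES w hw)).2.2.2
  refine ⟨fun s hs => hJ1a hS sub₁ hPS hQS huαS huβS hs, fun s hs => hIa hS sub₂ hPS hQS huαS huβS hs,
    fun hX => ?_, fun hX => ?_⟩
  · exact hJ2a hS sub₃ hPS hQS huαS huβS Complex.one_re (fun h => hX h.2)
  · exact hJ3a hS sub₄ hPS hQS huαS huβS Complex.one_re hX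

/-- **The analytic package of `L^S(s, τ × τ')` for two cuspidal Borel–Jacquet data on `GL₁(𝔸_F)`**
(two Hecke characters), with unitary a.e. Satake families: as `analyticPackage_fourFour`, the boundary
clauses being THEOREMS of the tree in rank one (Hecke, Landau: `JacquetShalika1981_partialPairL_boundary_repData_one_one`,
`JacquetShalika1981_partialPairL_pole_repData_rank_of_le_two`).
[cite: ArthurClozelAMS120, Ch. 3 §2 (2.1)–(2.3)] [cite: JacquetShalikaAJM1981, Thm. (5.3)] -/
theorem analyticPackage_oneOne
    {h1 : isCompact_glFiniteIntegralLevel 1 F} (τ τ' : CuspidalAutomorphicRepData 1 F h1)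
    (α β : SatakeFamily F)
    (hτ : ∀ᶠ w : HeightOneSpectrum (𝓞 F) in cofinite, τ.1.HasSatakeParamAt w (α w))
    (hτ' : ∀ᶠ w : HeightOneSpectrum (𝓞 F) in cofinite, τ'.1.HasSatakeParamAt w (β w))
    (huα : ∀ᶠ w : HeightOneSpectrum (𝓞 F) in cofinite, ‖(α w).prod‖ = 1)
    (huβ : ∀ᶠ w : HeightOneSpectrum (𝓞 F) in cofinite, ‖(β w).prod‖ = 1) :
    ∃ S₀ : Set (HeightOneSpectrum (𝓞 F)), S₀.Finite ∧
      ∀ {S : Set (HeightOneSpectrum (𝓞 F))} (_hS : S.Finite) (_hS₀ : S₀ ⊆ S),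
        (∀ s : ℂ, 1 < s.re → Multipliable fun v : {v : HeightOneSpectrum (𝓞 F) // v ∉ S} =>
          ((satakePairPolynomial (α v.1) (β v.1)).eval ((v.1.residueCard : ℂ) ^ (-s)))⁻¹) ∧
        (∀ s : ℂ, 1 < s.re → ContinuousAt (partialPairL S α β) s ∧ partialPairL S α β s ≠ 0) ∧
        ((¬ ∀ᶠ w : HeightOneSpectrum (𝓞 F) in cofinite,
            (α w).map ((((w.residueCard : ℂ) ^ (1 - (1 : ℂ)))) * ·) = (β w).map (·⁻¹)) →
          ∃ c : ℂ, c ≠ 0 ∧ Tendsto (partialPairL S α β) (𝓝[{s : ℂ | 1 < s.re}] 1) (𝓝 c)) ∧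
        ((∀ᶠ w : HeightOneSpectrum (𝓞 F) in cofinite,
            (α w).map ((((w.residueCard : ℂ) ^ (1 - (1 : ℂ)))) * ·) = (β w).map (·⁻¹)) →
          ∃ c : ℂ, c ≠ 0 ∧
            Tendsto (fun s => (s - 1) * partialPairL S α β s) (𝓝[{s : ℂ | 1 < s.re}] 1) (𝓝 c)) := by
  haveI : NeZero (1 : ℕ) := ⟨by norm_num⟩
  obtain ⟨S₁, hS₁, hJ1a⟩ :=
    JacquetShalika1981_multipliable_partialPairL_repData_holds 1 1 F h1 h1 one_pos one_pos τ τ'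
  obtain ⟨S₂, hS₂, hIa⟩ := continuousAt_and_ne_zero_partialPairL_repData τ τ'
  obtain ⟨S₃, hS₃, hJ2a⟩ := JacquetShalika1981_partialPairL_boundary_repData_one_one h1 h1 τ τ'
  obtain ⟨S₄, hS₄, hJ3a⟩ :=
    JacquetShalika1981_partialPairL_pole_repData_rank_of_le_two (n := 1) (by norm_num) h1 one_pos τ τ'
  have hgood : ∀ᶠ w : HeightOneSpectrum (𝓞 F) in cofinite, τ.1.HasSatakeParamAt w (α w) ∧
      τ'.1.HasSatakeParamAt w (β w) ∧ ‖(α w).prod‖ = 1 ∧ ‖(β w).prod‖ = 1 := by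
    filter_upwards [hτ, hτ', huα, huβ] with w h₁ h₂ h₃ h₄
    exact ⟨h₁, h₂, h₃, h₄⟩
  obtain ⟨E, hE, hgoodE⟩ : ∃ E : Set (HeightOneSpectrum (𝓞 F)), E.Finite ∧ ∀ w ∉ E,
      τ.1.HasSatakeParamAt w (α w) ∧ τ'.1.HasSatakeParamAt w (β w) ∧ ‖(α w).prod‖ = 1 ∧
      ‖(β w).prod‖ = 1 :=
    ⟨_, Filter.eventually_cofinite.1 hgood, fun w hw => not_not.1 hw⟩
  refine ⟨S₁ ∪ S₂ ∪ S₃ ∪ S₄ ∪ E, (((hS₁.union hS₂).union hS₃).union hS₄).union hE, ?_⟩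
  intro S hS hS₀
  have sub₁ : S₁ ⊆ S := fun x hx => hS₀ (by simp [hx])
  have sub₂ : S₂ ⊆ S := fun x hx => hS₀ (by simp [hx])
  have sub₃ : S₃ ⊆ S := fun x hx => hS₀ (by simp [hx])
  have sub₄ : S₄ ⊆ S := fun x hx => hS₀ (by simp [hx])
  have subE : E ⊆ S := fun x hx => hS₀ (by simp [hx])
  have hES : ∀ w ∉ S, w ∉ E := fun w hw h => hw (subE h)
  have hPS : ∀ w ∉ S, τ.1.HasSatakeParamAt w (α w) := fun w hw => (hgoodE w (hES w hw)).1
  have hQS : ∀ w ∉ S, τ'.1.HasSatakeParamAt w (β w) := fun w hw => (hgoodE w (hES w hw)).2.1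
  have huαS : ∀ w ∉ S, ‖(α w).prod‖ = 1 := fun w hw => (hgoodE w (hES w hw)).2.2.1
  have huβS : ∀ w ∉ S, ‖(β w).prod‖ = 1 := fun w hw => (hgoodE w (hES w hw)).2.2.2
  refine ⟨fun s hs => hJ1a hS sub₁ hPS hQS huαS huβS hs, fun s hs => hIa hS sub₂ hPS hQS huαS huβS hs,
    fun hX => ?_, fun hX => ?_⟩
  · exact hJ2a hS sub₃ hPS hQS huαS huβS Complex.one_re (fun h => hX h.2)
  · exact hJ3a hS sub₄ hPS hQS huαS huβS Complex.one_re hX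

/-- **At most a simple pole, with non-zero leading coefficient.**  From the two boundary clauses of a
package — a finite non-zero limit off `X`, a simple pole with non-zero residue in `X` — the slot
`L^S` satisfies `(s - 1)^k L^S(s) → c ≠ 0` for some `k ∈ ℕ`, and `k = 1` exactly when `X` holds.
[folklore] -/
theorem exists_pow_mul_tendsto_of_package {X : Prop} {L : ℂ → ℂ}
    (hoff : ¬ X → ∃ c : ℂ, c ≠ 0 ∧ Tendsto L (𝓝[{s : ℂ | 1 < s.re}] 1) (𝓝 c))
    (hon : X → ∃ c : ℂ, c ≠ 0 ∧
      Tendsto (fun s => (s - 1) * L s) (𝓝[{s : ℂ | 1 < s.re}] 1) (𝓝 c)) :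
    ∃ (k : ℕ) (c : ℂ), c ≠ 0 ∧ (X → k = 1) ∧
      Tendsto (fun s => (s - 1) ^ k * L s) (𝓝[{s : ℂ | 1 < s.re}] 1) (𝓝 c) := by
  by_cases hX : X
  · obtain ⟨c, hc, h⟩ := hon hX
    exact ⟨1, c, hc, fun _ => rfl, by simpa only [pow_one] using h⟩
  · obtain ⟨c, hc, h⟩ := hoff hX
    exact ⟨0, c, hc, fun h' => absurd h' hX, by simpa only [pow_zero, one_mul] using h⟩

end Packages

end Summit.Langlands.Langlands.Cruxes.ReducibleInducesSquare.Sketch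

end
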